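import Summits.BirchSwinnertonDyer.BirchSwinnertonDyer.Theorems.PrintCf2DisegniPairTwoTameBranchTransport
import Summits.BirchSwinnertonDyer.BirchSwinnertonDyer.Theorems.PrintCf2DisegniPairTwoTamePeriodTransportNeg
import Literature.NumberTheory.EllipticCurves.ImaginaryPeriodQuadraticTwistProofs
import HarnessLib

/-!
# Road (C) `disegni-pair-two` on crux stmt-BirchSwinnertonDyer-20368 — BIRCH TRANSPORT on the period side for the ODD classes:
# the minus period ratio `μ_V` (`μ_V·|Ω⁻(V)| = Ω⁻_{f_V}`) of the good twist `V = E^{(d)}` from the base, and the CANCELLATION of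
# Birch's constant against the sign-branch transport (`[T¹]L⁻₂` for the `χ₋₄`-class, `L⁻₂′(−2)` for the `χ₋₈`-class)

Cell `bsd-print-cf2`, width seat `bsd-line-cf2-p1-w8` g24; odd-class (`T⁻⁻`) twin of `PrintCf2DisegniPairTwoTamePeriodTransport[Neg].lean`
(memo `Cruxes/SplitBadTwoRankOneOfFacts/PERIOD-CANCELS-w8g24.md` §8, step G6). `--supports stmt-BirchSwinnertonDyer-20368` (helper). THEOREMS
ONLY (no `def`, no named fact, no `sorry`); conditional on every displayed hypothesis. BSD is not proved here; 20368 is not closed here.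

## The point

The odd-class defect keys (`defectKey_chi4_modulo_descent_min_of_Δ_neg`, `defectKey_chi8'_modulo_descent_min_of_Δ_neg`) price the
archimedean side by a MINUS period ratio `μ_V ∈ ℚˣ`, `μ_V·|Ω⁻(V)| = Ω⁻_{f_V}` — a datum of the optimal curve in the class of `V`, not
class-uniform in print. With `V = C₀ • E^{(d)}`: Birch (`exists_birchConstantMinus_two[_neg]`) gives ONE `c` with
`L⁻₂(f_V, α_V, ω) = C(c)(1+T)^{−ℓ}·G` AND `c²·|d|·(Ω⁻_{f_V})² = (Ω^∓_{f_E})²`; Pal for the imaginary period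
(`imaginaryPeriodRat_mul_sqrt_of_twist_of_pos`: `|Ω⁻(V)|·√d = |u(C₀)|·|Ω⁻(E)|`; `…_mul_numRealComponents_of_twist_of_neg`:
`|Ω⁻(V)|·√|d|·c_∞(E) = |u(C₀)|·Ω(E)`) makes `μ_V := μ_E/|c·u(C₀)|` (`d > 0`) resp. `μ_V := ϖ_E·c_∞(E)/|c·u(C₀)|` (`d < 0`) a minus period
ratio of `V`, and `c` CANCELS: `v₂(D_V) + v₂(μ_V) + v₂(u(C₀)) = v₂(D_G) + v₂(μ_E)` resp. `= v₂(D_G) + v₂(ϖ_E) + v₂(c_∞(E))`.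

## What is proved

* §1 `minusPeriodRatio_negTwist_of_birch`, `padicValRat_mul_div_abs_mul` — real / valuation algebra (`d < 0`; the `d > 0` algebra is the
  tree's `plusPeriodRatio_twist_of_birch` verbatim).
* §2 ★★ `exists_minusPeriodRatio_twist` (`d > 0`), `exists_minusPeriodRatio_negTwist` (`d < 0`) — `μ_V` from the base, with its valuation.
* §3 ★★★ `valuation_coeff_one_add_minusPeriodRatio_twist[_neg]` (`χ₋₄` object `[T¹]L⁻₂(f_V, α_V, ω)`) and
  `valuation_deriv_add_minusPeriodRatio_twist[_neg]` (`χ₋₈` object `Σ_k k[T^k]L⁻₂(−2)^{k−1}`): the cancellation identities above.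

References: B. Mazur, J. Tate, J. Teitelbaum, Invent. Math. 84 (1986) §I.8, §I.13 [MazurTateTeitelbaum1986Invent]; V. Pal, Proc. AMS 140
(2012) Thm. 3.2 [Pal2012]; K. Matsuno, J. Number Theory 84 (2000) §2 [Matsuno2000].
-/

set_option autoImplicit false
set_option linter.dupNamespace false

noncomputable section

open scoped Classical MatrixGroups ModularForm NumberField NumberTheorySymbols

open CongruenceSubgroup NumberField IsDedekindDomain WeierstrassCurve PowerSeries
  Literature.NumberTheory.EllipticCurves Literature.NumberTheory.EllipticCurves.ModularForms
  Literature.NumberTheory.EllipticCurves.GreenbergVatsal2000 Literature.NumberTheory.GaloisRepresentations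

namespace Summit.BirchSwinnertonDyer.BirchSwinnertonDyer.Theorems.PrintCf2.DisegniPairTwo

/-! ### §1 Real and valuation algebra (`d < 0`) -/

section AlgebraMinusNeg

/-- **The minus period ratio of a negative twist, explicitly**: from `c²·D·P_V² = P_E²` (Birch, `D = |d|`, `P_V = Ω⁻_{f_V}`,
`P_E = Ω⁺_{f_E}`), `|Ω⁻(V)|·√D·n = |u₀|·Ω(E)` (Pal, `n = c_∞(E)`) and `ϖ_E·Ω(E) = P_E` with `P_V, P_E > 0`, `c, u₀ ≠ 0`, `n > 0`:
`(ϖ_E·n/|c u₀|)·|Ω⁻(V)| = P_V`. [cite: MazurTateTeitelbaum1986Invent, §I.8] [cite: Pal2012, Thm. 3.2 (case d < 0)] -/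
theorem minusPeriodRatio_negTwist_of_birch {c ϖE u₀ : ℚ} {n : ℕ} {D ΩV ΩE PV PE : ℝ} (hD : 0 < D) (hc : c ≠ 0)
    (hu : u₀ ≠ 0) (hn : 0 < n) (hPV : 0 < PV) (hPE : 0 < PE) (hper : (c : ℝ) ^ 2 * D * PV ^ 2 = PE ^ 2)
    (hϖE : (ϖE : ℝ) * ΩE = PE) (hPal : ΩV * Real.sqrt D * n = |(u₀ : ℝ)| * ΩE) :
    ((ϖE * n / |c * u₀| : ℚ) : ℝ) * ΩV = PV := by
  have hsd : 0 < Real.sqrt D := Real.sqrt_pos.mpr hD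
  have hsq : Real.sqrt D ^ 2 = D := Real.sq_sqrt hD.le
  have hcR : (0 : ℝ) < |(c : ℝ)| := abs_pos.mpr (by exact_mod_cast hc)
  have huR : (0 : ℝ) < |(u₀ : ℝ)| := abs_pos.mpr (by exact_mod_cast hu)
  have hnR : (0 : ℝ) < (n : ℝ) := by exact_mod_cast hn
  have h1 : ((ϖE * n / |c * u₀| : ℚ) : ℝ) * ΩV = PE / (|(c : ℝ)| * Real.sqrt D) := by
    rw [eq_div_iff (mul_pos hcR hsd).ne']
    push_cast
    rw [abs_mul]
    have : (ϖE : ℝ) * n / (|(c : ℝ)| * |(u₀ : ℝ)|) * ΩV * (|(c : ℝ)| * Real.sqrt D) =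
        (ϖE : ℝ) * (ΩV * Real.sqrt D * n) / |(u₀ : ℝ)| := by
      field_simp
    rw [this, hPal, ← hϖE]
    field_simp
  have h2 : (PE / (|(c : ℝ)| * Real.sqrt D)) ^ 2 = PV ^ 2 := by
    rw [div_pow, mul_pow, sq_abs, hsq, ← hper]
    field_simp
  have h3 : 0 ≤ PE / (|(c : ℝ)| * Real.sqrt D) := (div_pos hPE (mul_pos hcR hsd)).le
  rw [h1]
  exact (pow_left_inj₀ h3 hPV.le two_ne_zero).mp h2

/-- `v_p(ϖ·n/|c·u|) = v_p(ϖ) + v_p(n) − v_p(c) − v_p(u)` for `ϖ, n, c, u ≠ 0`. [folklore] -/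
theorem padicValRat_mul_div_abs_mul {p : ℕ} [Fact p.Prime] {ϖ n c u : ℚ} (hϖ : ϖ ≠ 0) (hn : n ≠ 0) (hc : c ≠ 0)
    (hu : u ≠ 0) :
    padicValRat p (ϖ * n / |c * u|) = padicValRat p ϖ + padicValRat p n - padicValRat p c - padicValRat p u := by
  have hcu : |c * u| ≠ 0 := abs_ne_zero.mpr (mul_ne_zero hc hu)
  rw [padicValRat.div (mul_ne_zero hϖ hn) hcu, padicValRat.mul hϖ hn, padicValRat_abs_eq, padicValRat.mul hc hu]
  ring

end AlgebraMinusNeg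

/-! ### §2 The minus period ratio of the twist from the base -/

section Transport

variable (E : WeierstrassCurve ℚ) [E.IsElliptic] [E.IsGloballyMinimal] {d : ℤ} {V : WeierstrassCurve ℚ}
  [V.IsElliptic] [V.IsGloballyMinimal] [NeZero (E.conductorNorm ℤ)] [NeZero (V.conductorNorm ℤ)] [NeZero d.natAbs]
  {fE : CuspForm (Gamma0 (E.conductorNorm ℤ)) 2} {fV : CuspForm (Gamma0 (V.conductorNorm ℤ)) 2}

omit [E.IsGloballyMinimal] [V.IsGloballyMinimal] [NeZero d.natAbs] in
/-- ★★ **The minus period ratio of the twist from that of the base, `d > 0`.** For `μ_E ∈ ℚˣ` with `μ_E·|Ω⁻(E)| = Ω⁻_{f_E}` and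
Birch's constant `c` (`c²·d·(Ω⁻_{f_V})² = (Ω⁻_{f_E})²`): `μ_V := μ_E/|c·u(C₀)| ∈ ℚˣ` satisfies `μ_V·|Ω⁻(V)| = Ω⁻_{f_V}`
(Pal: `|Ω⁻(V)|·√d = |u(C₀)|·|Ω⁻(E)|`) and `v₂(μ_V) = v₂(μ_E) − v₂(c) − v₂(u(C₀))`. No parametrisation datum of `V` is used.
[cite: MazurTateTeitelbaum1986Invent, §I.8] [cite: Pal2012, Thm. 3.2 (case d > 0)] -/
theorem exists_minusPeriodRatio_twist (hd : 0 < d) {C₀ : VariableChange ℚ} (hV : C₀ • E.quadraticTwist (d : ℚ) = V)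
    (hfE : IsNewformOf E fE) (hfV : IsNewformOf V fV) {c : ℚ} (hc : c ≠ 0)
    (hper : (c : ℝ) ^ 2 * (d : ℝ) * minusPeriod fV ^ 2 = minusPeriod fE ^ 2)
    {μE : ℚ} (hμE0 : μE ≠ 0) (hμE : (μE : ℝ) * E.imaginaryPeriodRat = minusPeriod fE) :
    (μE / |c * (C₀.u : ℚ)|) ≠ 0 ∧ (((μE / |c * (C₀.u : ℚ)|) : ℚ) : ℝ) * V.imaginaryPeriodRat = minusPeriod fV ∧
      padicValRat 2 (μE / |c * (C₀.u : ℚ)|) = padicValRat 2 μE - padicValRat 2 c - padicValRat 2 (C₀.u : ℚ) := by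
  have hu : (C₀.u : ℚ) ≠ 0 := Units.ne_zero _
  have hPV : 0 < minusPeriod fV := IsNewform0.minusPeriod_pos_holds hfV.1 hfV.coeffField_eq_bot
  have hPE : 0 < minusPeriod fE := IsNewform0.minusPeriod_pos_holds hfE.1 hfE.coeffField_eq_bot
  have hdq : (0 : ℚ) < d := by exact_mod_cast hd
  have hPal := E.imaginaryPeriodRat_mul_sqrt_of_twist_of_pos hdq V C₀ hV
  have hPal' : V.imaginaryPeriodRat * Real.sqrt (d : ℝ) = |((C₀.u : ℚ) : ℝ)| * E.imaginaryPeriodRat := by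
    have e : (((d : ℚ)) : ℝ) = (d : ℝ) := Rat.cast_intCast d
    rw [← e]; exact hPal
  exact ⟨div_ne_zero hμE0 (abs_ne_zero.mpr (mul_ne_zero hc hu)),
    plusPeriodRatio_twist_of_birch hd hc hu hPV hPE hper hμE hPal', padicValRat_div_abs_mul hμE0 hc hu⟩

omit [E.IsGloballyMinimal] [V.IsGloballyMinimal] [NeZero d.natAbs] in
/-- ★★ **The minus period ratio of a NEGATIVE twist from the PLUS period ratio of the base.** For `ϖ_E ∈ ℚˣ` with
`ϖ_E·Ω(E) = Ω⁺_{f_E}` and Birch's constant `c` (`c²·|d|·(Ω⁻_{f_V})² = (Ω⁺_{f_E})²`): `μ_V := ϖ_E·c_∞(E)/|c·u(C₀)| ∈ ℚˣ` satisfies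
`μ_V·|Ω⁻(V)| = Ω⁻_{f_V}` (Pal, `d < 0`: `|Ω⁻(V)|·√|d|·c_∞(E) = |u(C₀)|·Ω(E)`) and
`v₂(μ_V) = v₂(ϖ_E) + v₂(c_∞(E)) − v₂(c) − v₂(u(C₀))`. [cite: MazurTateTeitelbaum1986Invent, §I.8] [cite: Pal2012, Thm. 3.2 (case d < 0)] -/
theorem exists_minusPeriodRatio_negTwist (hd : d < 0) {C₀ : VariableChange ℚ} (hV : C₀ • E.quadraticTwist (d : ℚ) = V)
    (hfE : IsNewformOf E fE) (hfV : IsNewformOf V fV) {c : ℚ} (hc : c ≠ 0)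
    (hper : (c : ℝ) ^ 2 * (d.natAbs : ℝ) * minusPeriod fV ^ 2 = plusPeriod fE ^ 2)
    {ϖE : ℚ} (hϖE0 : ϖE ≠ 0) (hϖE : (ϖE : ℝ) * E.realPeriodRat = plusPeriod fE) :
    (ϖE * ((E.baseChange ℝ).numRealComponents : ℚ) / |c * (C₀.u : ℚ)|) ≠ 0 ∧
      (((ϖE * ((E.baseChange ℝ).numRealComponents : ℚ) / |c * (C₀.u : ℚ)|) : ℚ) : ℝ) * V.imaginaryPeriodRat =
        minusPeriod fV ∧
      padicValRat 2 (ϖE * ((E.baseChange ℝ).numRealComponents : ℚ) / |c * (C₀.u : ℚ)|) =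
        padicValRat 2 ϖE + padicValRat 2 ((E.baseChange ℝ).numRealComponents : ℚ) - padicValRat 2 c -
          padicValRat 2 (C₀.u : ℚ) := by
  have hu : (C₀.u : ℚ) ≠ 0 := Units.ne_zero _
  have hn : 0 < (E.baseChange ℝ).numRealComponents := numRealComponents_baseChange_pos E
  have hnq : ((E.baseChange ℝ).numRealComponents : ℚ) ≠ 0 := by exact_mod_cast hn.ne'
  have hPV : 0 < minusPeriod fV := IsNewform0.minusPeriod_pos_holds hfV.1 hfV.coeffField_eq_bot
  have hPE : 0 < plusPeriod fE := IsNewform0.plusPeriod_pos_holds hfE.1 hfE.coeffField_eq_bot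
  have hdq : ((d : ℚ)) < 0 := by exact_mod_cast hd
  have hPal := E.imaginaryPeriodRat_mul_sqrt_mul_numRealComponents_of_twist_of_neg hdq V C₀ hV
  have hdm : (d.natAbs : ℝ) = -((d : ℚ) : ℝ) := by
    rw [← Int.cast_natCast (R := ℝ) d.natAbs, Int.natCast_natAbs, Int.cast_abs, Rat.cast_intCast,
      abs_of_neg (by exact_mod_cast hd : (d : ℝ) < 0)]
  have hD : (0 : ℝ) < (d.natAbs : ℝ) := by rw [hdm]; push_cast; exact_mod_cast neg_pos.mpr hd
  have hPal' : V.imaginaryPeriodRat * Real.sqrt (d.natAbs : ℝ) * ((E.baseChange ℝ).numRealComponents : ℕ) =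
      |((C₀.u : ℚ) : ℝ)| * E.realPeriodRat := by
    rw [hdm]; exact hPal
  refine ⟨div_ne_zero (mul_ne_zero hϖE0 hnq) (abs_ne_zero.mpr (mul_ne_zero hc hu)), ?_,
    padicValRat_mul_div_abs_mul hϖE0 hnq hc hu⟩
  have h := minusPeriodRatio_negTwist_of_birch (n := (E.baseChange ℝ).numRealComponents) hD hc hu hn hPV hPE hper hϖE hPal'
  have e : (((ϖE * ((E.baseChange ℝ).numRealComponents : ℚ) / |c * (C₀.u : ℚ)|) : ℚ) : ℝ) =
      (((ϖE * (E.baseChange ℝ).numRealComponents / |c * (C₀.u : ℚ)|) : ℚ) : ℝ) := by norm_cast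
  rw [e]
  exact h

/-! ### §3 Cancellation of Birch's constant, odd classes -/

/-- ★★★ **Cancellation, `χ₋₄` object, `d > 0`.** In the setting of `coeff_one_padicLFunctionMinusBranch_twist_eq` (`L⁻₂(f_V, α_V, ω; 0) = 0`)
with a minus period ratio `μ_E·|Ω⁻(E)| = Ω⁻_{f_E}` of the base: there is a minus period ratio `μ_V` of the twist such that `G(0) = 0`,
`[T¹]L⁻₂(f_V) ≠ 0 ↔ [T¹]G ≠ 0`, and, when `[T¹]G ≠ 0`, **`v₂([T¹]L⁻₂(f_V)) + v₂(μ_V) + v₂(u(C₀)) = v₂([T¹]G) + v₂(μ_E)`**.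
[cite: MazurTateTeitelbaum1986Invent, §I.8 and §I.13] [cite: Pal2012, Thm. 3.2 (case d > 0)] -/
theorem valuation_coeff_one_add_minusPeriodRatio_twist (hmod : exists_isNewformOf) (hd : 0 < d) (hd4 : d % 4 = 1)
    (hsq : Squarefree d) (hcop : IsCoprime d (E.conductorNorm ℤ : ℤ)) {C₀ : VariableChange ℚ}
    (hV : C₀ • E.quadraticTwist (d : ℚ) = V) (hfE : IsNewformOf E fE) (hfV : IsNewformOf V fV)
    (hord : IsOrdinaryAt E 2) {χ : MulChar (ZMod d.natAbs) ℤ}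
    (hχ : ∀ a : ZMod d.natAbs, χ a = J((a.val : ℤ) | d.natAbs))
    (h0 : PowerSeries.constantCoeff (padicLFunctionMinusBranch fV (unitRoot V 2 : ℚ_[2]) 1) = 0)
    {μE : ℚ} (hμE0 : μE ≠ 0) (hμE : (μE : ℝ) * E.imaginaryPeriodRat = minusPeriod fE) :
    ∃ μV : ℚ, μV ≠ 0 ∧ (μV : ℝ) * V.imaginaryPeriodRat = minusPeriod fV ∧
      PowerSeries.constantCoeff (padicLFunctionTameMinusBranch fE d.natAbs (unitRoot E 2 : ℚ_[2])
        ((χ.ringHomComp (Int.castRingHom ℚ)).ringHomComp (Rat.castHom ℚ_[2])) 1) = 0 ∧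
      (PowerSeries.coeff 1 (padicLFunctionMinusBranch fV (unitRoot V 2 : ℚ_[2]) 1) ≠ 0 ↔
        PowerSeries.coeff 1 (padicLFunctionTameMinusBranch fE d.natAbs (unitRoot E 2 : ℚ_[2])
          ((χ.ringHomComp (Int.castRingHom ℚ)).ringHomComp (Rat.castHom ℚ_[2])) 1) ≠ 0) ∧
      (PowerSeries.coeff 1 (padicLFunctionTameMinusBranch fE d.natAbs (unitRoot E 2 : ℚ_[2])
          ((χ.ringHomComp (Int.castRingHom ℚ)).ringHomComp (Rat.castHom ℚ_[2])) 1) ≠ 0 →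
        (PowerSeries.coeff 1 (padicLFunctionMinusBranch fV (unitRoot V 2 : ℚ_[2]) 1)).valuation + padicValRat 2 μV +
            padicValRat 2 (C₀.u : ℚ) =
          (PowerSeries.coeff 1 (padicLFunctionTameMinusBranch fE d.natAbs (unitRoot E 2 : ℚ_[2])
            ((χ.ringHomComp (Int.castRingHom ℚ)).ringHomComp (Rat.castHom ℚ_[2])) 1)).valuation + padicValRat 2 μE) := by
  obtain ⟨c, hc0, hper, hG0, -, hiff, hval⟩ :=
    coeff_one_padicLFunctionMinusBranch_twist_eq E hmod hd hd4 hsq hcop hV hfE hfV hord hχ h0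
  obtain ⟨hμV0, hμV, hvμV⟩ := exists_minusPeriodRatio_twist E hd hV hfE hfV hc0 hper hμE0 hμE
  refine ⟨_, hμV0, hμV, hG0, hiff, fun hG ↦ ?_⟩
  rw [hval hG, hvμV]
  ring

/-- ★★★ **Cancellation, `χ₋₄` object, `d < 0`** (PLUS tame branch `G` of `f_E`; plus period ratio `ϖ_E·Ω(E) = Ω⁺_{f_E}` of the base):
`μ_V` a minus period ratio of the twist with `G(0) = 0`, `[T¹]L⁻₂(f_V) ≠ 0 ↔ [T¹]G ≠ 0`, and
**`v₂([T¹]L⁻₂(f_V)) + v₂(μ_V) + v₂(u(C₀)) = v₂([T¹]G) + v₂(ϖ_E) + v₂(c_∞(E))`**.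
[cite: MazurTateTeitelbaum1986Invent, §I.8 and §I.13] [cite: Pal2012, Thm. 3.2 (case d < 0)] -/
theorem valuation_coeff_one_add_minusPeriodRatio_negTwist (hmod : exists_isNewformOf) (hd : d < 0) (hd4 : d % 4 = 1)
    (hsq : Squarefree d) (hcop : IsCoprime d (E.conductorNorm ℤ : ℤ)) {C₀ : VariableChange ℚ}
    (hV : C₀ • E.quadraticTwist (d : ℚ) = V) (hfE : IsNewformOf E fE) (hfV : IsNewformOf V fV)
    (hord : IsOrdinaryAt E 2) {χ : MulChar (ZMod d.natAbs) ℤ}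
    (hχ : ∀ a : ZMod d.natAbs, χ a = J((a.val : ℤ) | d.natAbs))
    (h0 : PowerSeries.constantCoeff (padicLFunctionMinusBranch fV (unitRoot V 2 : ℚ_[2]) 1) = 0)
    {ϖE : ℚ} (hϖE0 : ϖE ≠ 0) (hϖE : (ϖE : ℝ) * E.realPeriodRat = plusPeriod fE) :
    ∃ μV : ℚ, μV ≠ 0 ∧ (μV : ℝ) * V.imaginaryPeriodRat = minusPeriod fV ∧
      PowerSeries.constantCoeff (padicLFunctionTameBranch fE d.natAbs (unitRoot E 2 : ℚ_[2])
        ((χ.ringHomComp (Int.castRingHom ℚ)).ringHomComp (Rat.castHom ℚ_[2])) 1) = 0 ∧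
      (PowerSeries.coeff 1 (padicLFunctionMinusBranch fV (unitRoot V 2 : ℚ_[2]) 1) ≠ 0 ↔
        PowerSeries.coeff 1 (padicLFunctionTameBranch fE d.natAbs (unitRoot E 2 : ℚ_[2])
          ((χ.ringHomComp (Int.castRingHom ℚ)).ringHomComp (Rat.castHom ℚ_[2])) 1) ≠ 0) ∧
      (PowerSeries.coeff 1 (padicLFunctionTameBranch fE d.natAbs (unitRoot E 2 : ℚ_[2])
          ((χ.ringHomComp (Int.castRingHom ℚ)).ringHomComp (Rat.castHom ℚ_[2])) 1) ≠ 0 →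
        (PowerSeries.coeff 1 (padicLFunctionMinusBranch fV (unitRoot V 2 : ℚ_[2]) 1)).valuation + padicValRat 2 μV +
            padicValRat 2 (C₀.u : ℚ) =
          (PowerSeries.coeff 1 (padicLFunctionTameBranch fE d.natAbs (unitRoot E 2 : ℚ_[2])
            ((χ.ringHomComp (Int.castRingHom ℚ)).ringHomComp (Rat.castHom ℚ_[2])) 1)).valuation + padicValRat 2 ϖE +
            padicValRat 2 ((E.baseChange ℝ).numRealComponents : ℚ)) := by
  obtain ⟨c, hc0, hper, hG0, -, hiff, hval⟩ :=
    coeff_one_padicLFunctionMinusBranch_negTwist_eq E hmod hd hd4 hsq hcop hV hfE hfV hord hχ h0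
  obtain ⟨hμV0, hμV, hvμV⟩ := exists_minusPeriodRatio_negTwist E hd hV hfE hfV hc0 hper hϖE0 hϖE
  refine ⟨_, hμV0, hμV, hG0, hiff, fun hG ↦ ?_⟩
  rw [hval hG, hvμV]
  ring

/-- ★★★ **Cancellation, `χ₋₈` object, `d > 0`.** In the setting of `valuation_deriv_padicLFunctionMinusBranch_twist_eq` (vanishing of
`L⁻₂(f_V, α_V, ω; ·)` at `T = −2`) with a minus period ratio `μ_E·|Ω⁻(E)| = Ω⁻_{f_E}` of the base: there is a minus period ratio
`μ_V` of the twist such that `G` vanishes at `−2`, `D_V ≠ 0 ↔ D_G ≠ 0`, and, when `D_G ≠ 0`,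
**`v₂(D_V) + v₂(μ_V) + v₂(u(C₀)) = v₂(D_G) + v₂(μ_E)`**. [cite: MazurTateTeitelbaum1986Invent, §I.8 and §I.13]
[cite: Pal2012, Thm. 3.2 (case d > 0)] [cite: Matsuno2000, §2 (p. 84)] -/
theorem valuation_deriv_add_minusPeriodRatio_twist (hmod : exists_isNewformOf) (hd : 0 < d) (hd4 : d % 4 = 1)
    (hsq : Squarefree d) (hcop : IsCoprime d (E.conductorNorm ℤ : ℤ)) {C₀ : VariableChange ℚ}
    (hV : C₀ • E.quadraticTwist (d : ℚ) = V) (hfE : IsNewformOf E fE) (hfV : IsNewformOf V fV)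
    (hord : IsOrdinaryAt E 2) {χ : MulChar (ZMod d.natAbs) ℤ}
    (hχ : ∀ a : ZMod d.natAbs, χ a = J((a.val : ℤ) | d.natAbs))
    (h0 : HasSum (fun k : ℕ ↦ PowerSeries.coeff k (padicLFunctionMinusBranch fV (unitRoot V 2 : ℚ_[2]) 1) *
      (-2 : ℚ_[2]) ^ k) 0)
    {μE : ℚ} (hμE0 : μE ≠ 0) (hμE : (μE : ℝ) * E.imaginaryPeriodRat = minusPeriod fE) :
    ∃ μV : ℚ, μV ≠ 0 ∧ (μV : ℝ) * V.imaginaryPeriodRat = minusPeriod fV ∧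
      HasSum (fun k : ℕ ↦ PowerSeries.coeff k (padicLFunctionTameMinusBranch fE d.natAbs (unitRoot E 2 : ℚ_[2])
        ((χ.ringHomComp (Int.castRingHom ℚ)).ringHomComp (Rat.castHom ℚ_[2])) 1) * (-2 : ℚ_[2]) ^ k) 0 ∧
      ((∑' k : ℕ, PowerSeries.coeff k (padicLFunctionMinusBranch fV (unitRoot V 2 : ℚ_[2]) 1) * (k : ℚ_[2]) *
            (-2) ^ (k - 1)) ≠ 0 ↔
        (∑' k : ℕ, PowerSeries.coeff k (padicLFunctionTameMinusBranch fE d.natAbs (unitRoot E 2 : ℚ_[2])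
            ((χ.ringHomComp (Int.castRingHom ℚ)).ringHomComp (Rat.castHom ℚ_[2])) 1) * (k : ℚ_[2]) *
              (-2) ^ (k - 1)) ≠ 0) ∧
      ((∑' k : ℕ, PowerSeries.coeff k (padicLFunctionTameMinusBranch fE d.natAbs (unitRoot E 2 : ℚ_[2])
            ((χ.ringHomComp (Int.castRingHom ℚ)).ringHomComp (Rat.castHom ℚ_[2])) 1) * (k : ℚ_[2]) *
              (-2) ^ (k - 1)) ≠ 0 →
        (∑' k : ℕ, PowerSeries.coeff k (padicLFunctionMinusBranch fV (unitRoot V 2 : ℚ_[2]) 1) * (k : ℚ_[2]) *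
            (-2) ^ (k - 1)).valuation + padicValRat 2 μV + padicValRat 2 (C₀.u : ℚ) =
          (∑' k : ℕ, PowerSeries.coeff k (padicLFunctionTameMinusBranch fE d.natAbs (unitRoot E 2 : ℚ_[2])
            ((χ.ringHomComp (Int.castRingHom ℚ)).ringHomComp (Rat.castHom ℚ_[2])) 1) * (k : ℚ_[2]) *
              (-2) ^ (k - 1)).valuation + padicValRat 2 μE) := by
  obtain ⟨c, hc0, hper, hGsum, hiff, hval⟩ :=
    valuation_deriv_padicLFunctionMinusBranch_twist_eq E hmod hd hd4 hsq hcop hV hfE hfV hord hχ h0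
  obtain ⟨hμV0, hμV, hvμV⟩ := exists_minusPeriodRatio_twist E hd hV hfE hfV hc0 hper hμE0 hμE
  refine ⟨_, hμV0, hμV, hGsum, hiff, fun hG ↦ ?_⟩
  rw [hval hG, hvμV]
  ring

/-- ★★★ **Cancellation, `χ₋₈` object, `d < 0`** (PLUS tame branch `G` of `f_E`; plus period ratio `ϖ_E·Ω(E) = Ω⁺_{f_E}` of the base):
**`v₂(D_V) + v₂(μ_V) + v₂(u(C₀)) = v₂(D_G) + v₂(ϖ_E) + v₂(c_∞(E))`**. [cite: MazurTateTeitelbaum1986Invent, §I.8 and §I.13]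
[cite: Pal2012, Thm. 3.2 (case d < 0)] [cite: Matsuno2000, §2 (p. 84)] -/
theorem valuation_deriv_add_minusPeriodRatio_negTwist (hmod : exists_isNewformOf) (hd : d < 0) (hd4 : d % 4 = 1)
    (hsq : Squarefree d) (hcop : IsCoprime d (E.conductorNorm ℤ : ℤ)) {C₀ : VariableChange ℚ}
    (hV : C₀ • E.quadraticTwist (d : ℚ) = V) (hfE : IsNewformOf E fE) (hfV : IsNewformOf V fV)
    (hord : IsOrdinaryAt E 2) {χ : MulChar (ZMod d.natAbs) ℤ}
    (hχ : ∀ a : ZMod d.natAbs, χ a = J((a.val : ℤ) | d.natAbs))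
    (h0 : HasSum (fun k : ℕ ↦ PowerSeries.coeff k (padicLFunctionMinusBranch fV (unitRoot V 2 : ℚ_[2]) 1) *
      (-2 : ℚ_[2]) ^ k) 0)
    {ϖE : ℚ} (hϖE0 : ϖE ≠ 0) (hϖE : (ϖE : ℝ) * E.realPeriodRat = plusPeriod fE) :
    ∃ μV : ℚ, μV ≠ 0 ∧ (μV : ℝ) * V.imaginaryPeriodRat = minusPeriod fV ∧
      HasSum (fun k : ℕ ↦ PowerSeries.coeff k (padicLFunctionTameBranch fE d.natAbs (unitRoot E 2 : ℚ_[2])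
        ((χ.ringHomComp (Int.castRingHom ℚ)).ringHomComp (Rat.castHom ℚ_[2])) 1) * (-2 : ℚ_[2]) ^ k) 0 ∧
      ((∑' k : ℕ, PowerSeries.coeff k (padicLFunctionMinusBranch fV (unitRoot V 2 : ℚ_[2]) 1) * (k : ℚ_[2]) *
            (-2) ^ (k - 1)) ≠ 0 ↔
        (∑' k : ℕ, PowerSeries.coeff k (padicLFunctionTameBranch fE d.natAbs (unitRoot E 2 : ℚ_[2])
            ((χ.ringHomComp (Int.castRingHom ℚ)).ringHomComp (Rat.castHom ℚ_[2])) 1) * (k : ℚ_[2]) *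
              (-2) ^ (k - 1)) ≠ 0) ∧
      ((∑' k : ℕ, PowerSeries.coeff k (padicLFunctionTameBranch fE d.natAbs (unitRoot E 2 : ℚ_[2])
            ((χ.ringHomComp (Int.castRingHom ℚ)).ringHomComp (Rat.castHom ℚ_[2])) 1) * (k : ℚ_[2]) *
              (-2) ^ (k - 1)) ≠ 0 →
        (∑' k : ℕ, PowerSeries.coeff k (padicLFunctionMinusBranch fV (unitRoot V 2 : ℚ_[2]) 1) * (k : ℚ_[2]) *
            (-2) ^ (k - 1)).valuation + padicValRat 2 μV + padicValRat 2 (C₀.u : ℚ) =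
          (∑' k : ℕ, PowerSeries.coeff k (padicLFunctionTameBranch fE d.natAbs (unitRoot E 2 : ℚ_[2])
            ((χ.ringHomComp (Int.castRingHom ℚ)).ringHomComp (Rat.castHom ℚ_[2])) 1) * (k : ℚ_[2]) *
              (-2) ^ (k - 1)).valuation + padicValRat 2 ϖE + padicValRat 2 ((E.baseChange ℝ).numRealComponents : ℚ)) := by
  obtain ⟨c, hc0, hper, hGsum, hiff, hval⟩ :=
    valuation_deriv_padicLFunctionMinusBranch_negTwist_eq E hmod hd hd4 hsq hcop hV hfE hfV hord hχ h0
  obtain ⟨hμV0, hμV, hvμV⟩ := exists_minusPeriodRatio_negTwist E hd hV hfE hfV hc0 hper hϖE0 hϖE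
  refine ⟨_, hμV0, hμV, hGsum, hiff, fun hG ↦ ?_⟩
  rw [hval hG, hvμV]
  ring

end Transport

end Summit.BirchSwinnertonDyer.BirchSwinnertonDyer.Theorems.PrintCf2.DisegniPairTwo

end
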